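import Mathlib.Analysis.Distribution.Sobolev
import Mathlib.Analysis.Fourier.LpSpace
import Mathlib.MeasureTheory.Measure.WithDensity
import Literature.Analysis.FunctionSpaces.BesselSobolevSpace
import HarnessLib

-- provenance: harness21/H21/H21/Prelude/Sobolev/FourierSobolevNorm.lean @ 04f08e6 (interim HEAD d8f2665); M5 mechanical rewrite
/-!
# Fourier-side `H^s` and homogeneous `Ḣ^s` norms on `ℝⁿ`; the bundled space `Ḣ^s`

Trunk: Sobolev (outline `H21/Outlines/Sobolev.md`, item C7; notion `sobolev_Hsp_bessel_Rn`,
part 2). Part 1 (`Literature.Analysis.FunctionSpaces.BesselSobolev`, the bundled Bessel-potential spaces `H^{s,p}`) is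
`H21/Prelude/Sobolev/BesselSobolevSpace.lean`.

For an `L²` function `f` on a finite-dimensional real inner product space `E` (think `ℝⁿ`) with
values in a complex Hilbert space `F`, the inhomogeneous and homogeneous Sobolev (semi)norms are
`‖f‖_{H^s}² = ∫ (1 + |ξ|²)^s |𝓕f(ξ)|² dξ` and `‖f‖_{Ḣ^s}² = ∫ |ξ|^{2s} |𝓕f(ξ)|² dξ`
(Bahouri–Chemin–Danchin, *Fourier Analysis and Nonlinear PDE* (2011), Def. 1.31 and §1.4.1;
Taylor, *PDE I*, Ch. 4 §1). This file defines them as `ℝ≥0∞`-valued functionals of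
`f : Lp F 2 volume` using Mathlib's `L²` Fourier transform
`MeasureTheory.Lp.fourierTransformₗᵢ E F : Lp F 2 ≃ₗᵢ[ℂ] Lp F 2` (notation `𝓕 f`,
`Mathlib/Analysis/Fourier/LpSpace.lean`, Plancherel), function-level wrappers
`Function.eSobolevNorm`, `Function.eHomSobolevSeminorm` (junk value `∞` off `L²`), membership
predicates `MemFourierSobolev`, `MemHomSobolev`, and the bundled Hilbert space
`HomSobolev E F s = Ḣ^s` realised on the Fourier side as `L²(E, ‖ξ‖^{2s} dξ; F)`.

## Relation to Mathlib

Mathlib has the predicate `TemperedDistribution.MemSobolev s p (f : 𝓢'(E, F))`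
(`Mathlib/Analysis/Distribution/Sobolev.lean`) and, for `p = 2`, the characterisation
`memSobolev_iff_exists_smulLeftCLM_fourier`: `f ∈ H^s ↔ (1+‖ξ‖²)^{s/2} 𝓕f ∈ L²`. Since
`‖(1+‖ξ‖²)^{s/2} 𝓕f‖_{L²}² = ∫ (1+‖ξ‖²)^s ‖𝓕f‖²`, the weight `(1+‖ξ‖²)^s` used below gives
*the same* norm as Mathlib's Bessel-potential norm for `p = 2` (not merely an equivalent one);
`memSobolev_two_iff_eFourierSobolevNorm_lt_top` records the bridge. Mathlib has no homogeneous
Sobolev spaces and no function-level `H^s` norm; `Measure.withDensity` supplies the weighted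
`L²` carrier of `Ḣ^s`.

## Design

* All norms are `ℝ≥0∞`-valued (`e`-prefix, like `eLpNorm`), so that no finiteness hypothesis is
  needed to state them.
* `HomSobolev E F s` is the *Fourier-side* carrier `Lp F 2 (volume.withDensity (‖·‖ₑ^{2s}))`:
  an element is (the Fourier transform `𝓕u` of) a homogeneous Sobolev distribution `u`. For
  `s < dim E / 2` this is exactly `Ḣ^s` of Bahouri–Chemin–Danchin, Def. 1.31 / Prop. 1.34 (the
  space of tempered distributions with `𝓕u ∈ L¹_loc` and `‖ξ‖^s 𝓕u ∈ L²`, a Hilbert space iff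
  `s < d/2`); `HomSobolev.exists_temperedDistribution` records the passage back to `𝓢'`.
* `MemHomSobolev s f` for a *function* `f` requires `f ∈ L²` (to make sense of `𝓕f`), so it
  describes `Ḣ^s ∩ L²`, not all of `Ḣ^s`.

## References

* H. Bahouri, J.-Y. Chemin, R. Danchin, *Fourier Analysis and Nonlinear Partial Differential
  Equations*, Springer (2011), §1.3–1.4 (Def. 1.31, Prop. 1.32, Prop. 1.34, Thm. 1.38).
* M. Taylor, *Partial Differential Equations I*, 2nd ed. (2011), Ch. 4 §1.
-/

noncomputable section

open MeasureTheory TemperedDistribution ENNReal FourierTransform Module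
open scoped SchwartzMap NNReal

namespace Literature.Analysis.FunctionSpaces

variable {E F : Type*} [NormedAddCommGroup E] [InnerProductSpace ℝ E] [FiniteDimensional ℝ E]
  [MeasurableSpace E] [BorelSpace E] [NormedAddCommGroup F] [InnerProductSpace ℂ F]
  [CompleteSpace F]

/-! ### Norms of `L²` functions -/

/-- The (extended-real-valued) inhomogeneous Sobolev norm of order `s` of an `L²` function `f`,
`‖f‖_{H^s} = (∫ (1 + ‖ξ‖²)^s ‖𝓕f(ξ)‖² dξ)^{1/2}` (Bahouri–Chemin–Danchin 2011, §1.4.1;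
Taylor, *PDE I*, Ch. 4 (1.1)). For `p = 2` this is *equal* to Mathlib's Bessel-potential norm
`‖⟨D⟩^s f‖_{L²}` (see `memSobolev_two_iff_eFourierSobolevNorm_lt_top`). [cite: BahouriCheminDanchin2011, §1.4.1] -/
def eFourierSobolevNorm (s : ℝ) (f : Lp F 2 (volume : Measure E)) : ℝ≥0∞ :=
  (∫⁻ ξ, ENNReal.ofReal ((1 + ‖ξ‖ ^ 2) ^ s) *
    ‖((𝓕 f : Lp F 2 (volume : Measure E)) : E → F) ξ‖ₑ ^ 2) ^ (1 / 2 : ℝ)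

/-- The (extended-real-valued) homogeneous Sobolev seminorm of order `s` of an `L²` function `f`,
`‖f‖_{Ḣ^s} = (∫ ‖ξ‖^{2s} ‖𝓕f(ξ)‖² dξ)^{1/2}` (Bahouri–Chemin–Danchin 2011, Def. 1.31). [cite: BahouriCheminDanchin2011, Def. 1.31] -/
def eHomSobolevSeminorm (s : ℝ) (f : Lp F 2 (volume : Measure E)) : ℝ≥0∞ :=
  (∫⁻ ξ, ‖ξ‖ₑ ^ (2 * s) * ‖((𝓕 f : Lp F 2 (volume : Measure E)) : E → F) ξ‖ₑ ^ 2) ^ (1 / 2 : ℝ)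

/-! ### Norms and membership predicates for functions -/

/-- The inhomogeneous Sobolev norm `‖f‖_{H^s} ∈ ℝ≥0∞` of a function `f : E → F`
(Bahouri–Chemin–Danchin 2011, §1.4.1): the norm `eFourierSobolevNorm s` of its class in `L²`.
**Junk value:** `∞` if `f ∉ L²` (then `𝓕f` is not defined at this level). [cite: BahouriCheminDanchin2011, §1.4.1] -/
def _root_.Function.eSobolevNorm (s : ℝ) (f : E → F) : ℝ≥0∞ :=
  open scoped Classical in
  if h : MemLp f 2 (volume : Measure E) then eFourierSobolevNorm s (h.toLp f) else ∞

/-- The homogeneous Sobolev seminorm `‖f‖_{Ḣ^s} ∈ ℝ≥0∞` of a function `f : E → F`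
(Bahouri–Chemin–Danchin 2011, Def. 1.31): the seminorm `eHomSobolevSeminorm s` of its class in
`L²`. **Junk value:** `∞` if `f ∉ L²`. [cite: BahouriCheminDanchin2011, Def. 1.31] -/
def _root_.Function.eHomSobolevSeminorm (s : ℝ) (f : E → F) : ℝ≥0∞ :=
  open scoped Classical in
  if h : MemLp f 2 (volume : Measure E) then Literature.Analysis.FunctionSpaces.eHomSobolevSeminorm s (h.toLp f) else ∞

/-- `MemFourierSobolev s f`: the function `f : E → F` lies in `H^s`, i.e. `f ∈ L²` and
`∫ (1 + ‖ξ‖²)^s ‖𝓕f‖² < ∞` (Bahouri–Chemin–Danchin 2011, §1.4.1; Taylor, *PDE I*, Ch. 4 §1). [cite: BahouriCheminDanchin2011, §1.4.1] -/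
def MemFourierSobolev (s : ℝ) (f : E → F) : Prop :=
  ∃ h : MemLp f 2 (volume : Measure E), eFourierSobolevNorm s (h.toLp f) < ∞

variable (E) in
/-- The Fourier-side weight measure `‖ξ‖^{2s} dξ` on `E` defining `Ḣ^s`
(Bahouri–Chemin–Danchin 2011, Def. 1.31). [cite: BahouriCheminDanchin2011, Def. 1.31] -/
def homSobolevMeasure (s : ℝ) : Measure E :=
  (volume : Measure E).withDensity fun ξ => ‖ξ‖ₑ ^ (2 * s)

/-- Unfolding of `homSobolevMeasure` (Bahouri–Chemin–Danchin 2011, Def. 1.31). [cite: BahouriCheminDanchin2011, Def. 1.31] -/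
theorem homSobolevMeasure_def (s : ℝ) :
    homSobolevMeasure E s = (volume : Measure E).withDensity fun ξ => ‖ξ‖ₑ ^ (2 * s) := rfl

/-- `MemHomSobolev s f`: the function `f : E → F` lies in `Ḣ^s ∩ L²`, i.e. `f ∈ L²` and
`𝓕f ∈ L²(‖ξ‖^{2s} dξ)` (Bahouri–Chemin–Danchin 2011, Def. 1.31). Note that this is
`Ḣ^s ∩ L²`, *not* the full homogeneous space `Ḣ^s` (whose elements need not be `L²`
functions); the latter is the bundled type `HomSobolev E F s`. [cite: BahouriCheminDanchin2011, Def. 1.31] -/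
def MemHomSobolev (s : ℝ) (f : E → F) : Prop :=
  ∃ h : MemLp f 2 (volume : Measure E),
    MemLp ((𝓕 (h.toLp f) : Lp F 2 (volume : Measure E)) : E → F) 2 (homSobolevMeasure E s)

/-! ### The bundled homogeneous Sobolev space `Ḣ^s` -/

variable (E F) in
/-- The homogeneous Sobolev space `Ḣ^s(E; F)` (Bahouri–Chemin–Danchin 2011, Def. 1.31),
realised on the Fourier side: an element is a class `g ∈ L²(E, ‖ξ‖^{2s} dξ; F)`, to be thought
of as `g = 𝓕u`, with `‖u‖_{Ḣ^s} = ‖g‖_{L²(‖ξ‖^{2s} dξ)}` by definition. For `s < dim E / 2`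
(and `dim E ≥ 1`) this is exactly BCD's `Ḣ^s`, a Hilbert space (BCD Prop. 1.34); see
`HomSobolev.exists_temperedDistribution` for the distribution `u = 𝓕⁻¹ g`. [cite: BahouriCheminDanchin2011, Def. 1.31] -/
def HomSobolev (s : ℝ) : Type _ := Lp F 2 (homSobolevMeasure E s)

namespace HomSobolev

variable (s : ℝ)

/-- `Ḣ^s` is a normed additive commutative group with `‖g‖ = ‖g‖_{L²(‖ξ‖^{2s} dξ)}`
(Bahouri–Chemin–Danchin 2011, Def. 1.31). Inherited from `Lp`. [cite: BahouriCheminDanchin2011, Def. 1.31] -/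
instance instNormedAddCommGroup : NormedAddCommGroup (HomSobolev E F s) :=
  inferInstanceAs (NormedAddCommGroup (Lp F 2 (homSobolevMeasure E s)))

/-- `Ḣ^s` is a complex inner product space (Bahouri–Chemin–Danchin 2011, Prop. 1.34).
Inherited from `MeasureTheory.L2.innerProductSpace`. [cite: BahouriCheminDanchin2011, Prop. 1.34] -/
instance instInnerProductSpace : InnerProductSpace ℂ (HomSobolev E F s) :=
  inferInstanceAs (InnerProductSpace ℂ (Lp F 2 (homSobolevMeasure E s)))

/-- `Ḣ^s` (Fourier-side realisation) is complete (Bahouri–Chemin–Danchin 2011, Prop. 1.34).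
Inherited from completeness of `Lp`. [cite: BahouriCheminDanchin2011, Prop. 1.34] -/
instance instCompleteSpace : CompleteSpace (HomSobolev E F s) :=
  inferInstanceAs (CompleteSpace (Lp F 2 (homSobolevMeasure E s)))

/-- The stored weighted-`L²` class `g = 𝓕u` of an element of `Ḣ^s` (the identity on the
carrier; Bahouri–Chemin–Danchin 2011, Def. 1.31). [cite: BahouriCheminDanchin2011, Def. 1.31] -/
def toLp : HomSobolev E F s ≃ₗᵢ[ℂ] Lp F 2 (homSobolevMeasure E s) :=
  LinearIsometryEquiv.refl ℂ _

omit [CompleteSpace F] in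
/-- The norm on `Ḣ^s` is the weighted `L²` norm of the stored class
(Bahouri–Chemin–Danchin 2011, Def. 1.31). [cite: BahouriCheminDanchin2011, Def. 1.31] -/
theorem norm_def (g : HomSobolev E F s) : ‖g‖ = ‖toLp s g‖ := rfl

variable {s}

/-- The element of `Ḣ^s` defined by a function `f ∈ Ḣ^s ∩ L²`, namely (the class of) `𝓕f`
in `L²(‖ξ‖^{2s} dξ)` (Bahouri–Chemin–Danchin 2011, Def. 1.31). [cite: BahouriCheminDanchin2011, Def. 1.31] -/
def ofFun (f : E → F) (hf : MemHomSobolev s f) : HomSobolev E F s :=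
  (toLp s).symm (hf.choose_spec.toLp _)

/-- The `Ḣ^s` norm of `ofFun f hf` is the homogeneous Sobolev seminorm of `f`
(Bahouri–Chemin–Danchin 2011, Def. 1.31). [cite: BahouriCheminDanchin2011, Def. 1.31] -/
def norm_ofFun : Prop :=
  ∀ (f : E → F) (hf : MemHomSobolev s f),
    ‖ofFun f hf‖ = (Function.eHomSobolevSeminorm s f).toReal

/-- Every element `g` of (the Fourier-side realisation of) `Ḣ^s` with `s < d/2`, `d ≥ 1`,
defines a tempered distribution `u = 𝓕⁻¹ g`, i.e. `u(φ) = ∫ g(ξ) · (𝓕⁻¹φ)(ξ) dξ` for all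
Schwartz `φ` (Bahouri–Chemin–Danchin 2011, Prop. 1.34: for `s < d/2`, `Ḣ^s` is a Hilbert space
of tempered distributions with `𝓕u ∈ L¹_loc`). Note the *inverse* Fourier transform `𝓕⁻ φ` in
the pairing (`u = 𝓕⁻¹ g`, and `⟨𝓕⁻¹ g, φ⟩ = ⟨g, 𝓕⁻¹ φ⟩`). The integral is taken w.r.t. `volume`
of a representative of a `‖ξ‖^{2s} dξ`-a.e. class; it is well defined because the density
`‖ξ‖^{2s}` is `volume`-a.e. positive and finite when `dim E ≥ 1`, so the two measures have the
same null sets. [cite: BahouriCheminDanchin2011, Prop. 1.34: for  s < d/2    Ḣ^s  is a Hi] -/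
def exists_temperedDistribution : Prop :=
  ∀ (hs : 2 * s < finrank ℝ E) (hE : 0 < finrank ℝ E) (g : HomSobolev E F s),
    ∃ u : 𝓢'(E, F), ∀ φ : 𝓢(E, ℂ),
      u φ = ∫ ξ, (𝓕⁻ φ) ξ • ((toLp s g : Lp F 2 (homSobolevMeasure E s)) : E → F) ξ

end HomSobolev

/-! ### Bridge and sanity statements -/

/-- Bridge to Mathlib: an `L²` function `f` lies in Mathlib's Sobolev class `MemSobolev s 2`
(as a tempered distribution) iff its Fourier-side `H^s` norm is finite; the two norms coincide
since `‖(1+‖ξ‖²)^{s/2} 𝓕f‖_{L²}² = ∫ (1+‖ξ‖²)^s ‖𝓕f‖²` (Taylor, *PDE I*, Ch. 4 (1.1);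
Mathlib `memSobolev_iff_exists_smulLeftCLM_fourier`). Stated for all real `s` (for `s < 0`
both sides hold automatically for `f ∈ L²`). [cite: TaylorPDEI2011, Ch. 4 §1 (1.1) (H^s via the Fourier weight)] -/
def memSobolev_two_iff_eFourierSobolevNorm_lt_top : Prop :=
  ∀ (s : ℝ) (f : Lp F 2 (volume : Measure E)),
    MemSobolev s 2 (f : 𝓢'(E, F)) ↔ eFourierSobolevNorm s f < ∞

/-- Plancherel: the `H^0` norm is the `L²` norm (Bahouri–Chemin–Danchin 2011, Thm. 1.24;
Mathlib `MeasureTheory.Lp.norm_fourier_eq`). [cite: BahouriCheminDanchin2011, Thm. 1.24] -/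
theorem eFourierSobolevNorm_zero_eq_enorm (f : Lp F 2 (volume : Measure E)) :
    eFourierSobolevNorm 0 f = ‖f‖ₑ := by
  rw [← ofReal_norm, ← Lp.norm_fourier_eq f, ofReal_norm, Lp.enorm_def,
    eLpNorm_eq_lintegral_rpow_enorm_toReal two_ne_zero ENNReal.ofNat_ne_top,
    eFourierSobolevNorm]
  simp only [Real.rpow_zero, ENNReal.ofReal_one, one_mul, ENNReal.toReal_ofNat,
    ENNReal.rpow_ofNat]

/-- `‖f‖_{Ḣ^s} ≤ ‖f‖_{H^s}` for `s ≥ 0`, since `‖ξ‖^{2s} ≤ (1 + ‖ξ‖²)^s`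
(Bahouri–Chemin–Danchin 2011, §1.4.1, `H^s = Ḣ^s ∩ L²` for `s ≥ 0`). [cite: BahouriCheminDanchin2011, §1.4.1   H^s = Ḣ^s ∩ L²  for  s ≥ 0] -/
def eHomSobolevSeminorm_le : Prop :=
  ∀ {s : ℝ} (hs : 0 ≤ s) (f : Lp F 2 (volume : Measure E)),
    eHomSobolevSeminorm s f ≤ eFourierSobolevNorm s f

/-- Scaling of the homogeneous seminorm: `‖f(λ·)‖_{Ḣ^s} = λ^{s - d/2} ‖f‖_{Ḣ^s}` for `λ > 0`,
`d = dim E` (Bahouri–Chemin–Danchin 2011, remark after Def. 1.31 / proof of Thm. 1.38). Stated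
for the function-level seminorm; if `f ∉ L²` both sides are `∞`. [cite: BahouriCheminDanchin2011, remark after Def. 1.31 / proof of Thm. 1] -/
def eHomSobolevSeminorm_comp_smul : Prop :=
  ∀ (s : ℝ) (f : E → F) {c : ℝ} (hc : 0 < c),
    Function.eHomSobolevSeminorm s (fun x => f (c • x)) =
      ENNReal.ofReal (c ^ (s - (finrank ℝ E : ℝ) / 2)) * Function.eHomSobolevSeminorm s f

/-- The critical Sobolev embedding `Ḣ^{1/2}(ℝ³) ↪ L³(ℝ³)`: there is a constant `C` with
`‖f‖_{L³} ≤ C ‖f‖_{Ḣ^{1/2}}` for every `f ∈ L²(ℝ³)` (Bahouri–Chemin–Danchin 2011, Thm. 1.38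
with `d = 3`, `s = 1/2`, `p = 2d/(d-2s) = 3`). [cite: BahouriCheminDanchin2011, Thm. 1.38 with  d = 3    s = 1/2    p =] -/
def eLpNorm_three_le_eHomSobolevSeminorm_half : Prop :=
  ∀ {F : Type*} [NormedAddCommGroup F] [InnerProductSpace ℂ F] [CompleteSpace F],
    ∃ C : ℝ≥0, ∀ f : EuclideanSpace ℝ (Fin 3) → F, MemLp f 2 volume →
      eLpNorm f 3 volume ≤ C * Function.eHomSobolevSeminorm (1 / 2 : ℝ) f

/-- `H^s ⊆ Ḣ^s ∩ L²` for `s ≥ 0` (Bahouri–Chemin–Danchin 2011, §1.4.1). [cite: BahouriCheminDanchin2011, §1.4.1] -/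
def MemFourierSobolev.memHomSobolev : Prop :=
  ∀ {s : ℝ} (hs : 0 ≤ s) {f : E → F} (hf : MemFourierSobolev s f),
    MemHomSobolev s f

end Literature.Analysis.FunctionSpaces
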